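import Summits.NavierStokesRegularity.NavierStokesRegularity.Theorems.PoloidalWindowDoorPoloidalWindowRigidityZShockRotatingProfile
import HarnessLib

/-!
# Crux K2 `PoloidalWindowRigidity` (stmt-NavierStokesRegularity-19708), line `z_shock` — R3 inhabitant census: ROTATING PATTERNS of the
# autonomous thick height-evolution (VIIa) — calculus of the plane-wave superposition `Ψ(y) = ∫₀^{2π} cos(k(y₀ cos t + y₁ sin t) − t) dt`

`--supports stmt-NavierStokesRegularity-19708 --as helper` (leafhand-ns-poloidalwindowdoor-3 g9, cell decomp-ns, 2026-08-31).  Class-free,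
def-free; Mathlib + part I (`…ZShockRotatingProfile`, coordinate derivatives only).  **No stub and no summit is closed by this file;
Navier–Stokes regularity is NOT proved here (rung 0).**

WHY THIS FILE.  Parts I–VI typed the rotating-pattern inhabitant candidates `W(s,y) = Ψ(R_{ωs}y)` of the autonomous column by the profile
equation `ω² ΘΘΨ = Σᵢ ∂ᵢ(γ(Ψ)∂ᵢΨ)`; the would-be rigidity lemma («bounded `C²` profiles are constant») carries the THICK clause `γ' ≢ 0`.
Part VII (`…LinearWitness`, next file) shows the clause is load-bearing by exhibiting, for `γ ≡ c²`, the bounded non-constant rotating profile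

  `Ψ(y) = ∫₀^{2π} cos(k (y₀ cos t + y₁ sin t) − t) dt`   (a Bessel spiral mode `J₁(k|y|)e^{iθ}`, written without Bessel functions).

This file is its calculus: the integrand `y ↦ cos(k(y₀ cos t + y₁ sin t) − t)` and its first two `y`-derivatives
(`hasFDerivAt_planeWave`, `hasFDerivAt_planeWave_deriv`, with the covector `L t = cos t·pr₀ + sin t·pr₁`), their continuity and uniform bounds,
and — by differentiation under the integral sign twice (`intervalIntegral.hasFDerivAt_integral_of_dominated_of_fderiv_le`) —
★ `witness_hasFDerivAt` (`DΨ(y) = ∫ −sin(·)·k L t dt`), ★ `witness_deriv_hasFDerivAt` (`D²Ψ(y) = ∫ −cos(·)·(k L t) ⊗ (k L t) dt`),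
★ `witness_contDiff` (`Ψ ∈ C²`, via `contDiff_succ_iff_hasFDerivAt`) and `witness_abs_le` (`|Ψ| ≤ 2π`).  The functions `Ψ, Ψ', Ψ''` enter
through defining hypotheses `hΨ, hΨ', hΨ''` (no definitions).  Technical remark kept for successors: in the scalar-valued application of the
dominated-derivative lemma all type/instance arguments are fixed first (`@… ℝ _ volume ℝ …`); elaborating it with named arguments makes the
unifier diverge on `NormedSpace.toModule ?inst =?= Module ℝ ℝ`.

Elementary analysis. presearch: classical (Watson, *Bessel Functions* §2.2, integral representations); nothing to cite beyond folklore. [folklore]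
-/

noncomputable section

namespace Summit.NavierStokesRegularity.NavierStokesRegularity.Theorems.PoloidalWindowDoorPoloidalWindowRigidityZShockRotatingProfileLinearWitnessCalculus

-- the summit and its single sub-problem share the name (CONVENTIONS §1)
set_option linter.dupNamespace false

open Set Filter Topology Function MeasureTheory intervalIntegral
open Summit.NavierStokesRegularity.NavierStokesRegularity.Theorems.PoloidalWindowDoorPoloidalWindowRigidityZShockRotatingProfile

variable {L : ℝ → EuclideanSpace ℝ (Fin 2) →L[ℝ] ℝ} {k : ℝ}

/-! ### The plane-wave integrand and its derivatives -/

/-- The linear form `L t = cos t·pr₀ + sin t·pr₁` evaluates to `h₀ cos t + h₁ sin t`. [folklore] -/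
theorem radialForm_apply
    (hL : ∀ t, L t = Real.cos t • (EuclideanSpace.proj (𝕜 := ℝ) (0 : Fin 2) : EuclideanSpace ℝ (Fin 2) →L[ℝ] ℝ) +
      Real.sin t • (EuclideanSpace.proj (𝕜 := ℝ) (1 : Fin 2) : EuclideanSpace ℝ (Fin 2) →L[ℝ] ℝ))
    (t : ℝ) (h : EuclideanSpace ℝ (Fin 2)) : L t h = h 0 * Real.cos t + h 1 * Real.sin t := by
  rw [hL]
  simp only [add_apply, smul_apply, smul_eq_mul, proj_zero_apply, proj_one_apply]
  ring

/-- `‖L t‖ ≤ ‖pr₀‖ + ‖pr₁‖`. [folklore] -/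
theorem norm_radialForm_le
    (hL : ∀ t, L t = Real.cos t • (EuclideanSpace.proj (𝕜 := ℝ) (0 : Fin 2) : EuclideanSpace ℝ (Fin 2) →L[ℝ] ℝ) +
      Real.sin t • (EuclideanSpace.proj (𝕜 := ℝ) (1 : Fin 2) : EuclideanSpace ℝ (Fin 2) →L[ℝ] ℝ))
    (t : ℝ) : ‖L t‖ ≤ ‖(EuclideanSpace.proj (𝕜 := ℝ) (0 : Fin 2) : EuclideanSpace ℝ (Fin 2) →L[ℝ] ℝ)‖ +
      ‖(EuclideanSpace.proj (𝕜 := ℝ) (1 : Fin 2) : EuclideanSpace ℝ (Fin 2) →L[ℝ] ℝ)‖ := by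
  rw [hL]
  refine (norm_add_le _ _).trans (add_le_add ?_ ?_)
  · rw [norm_smul, Real.norm_eq_abs]
    exact mul_le_of_le_one_left (norm_nonneg _) (Real.abs_cos_le_one t)
  · rw [norm_smul, Real.norm_eq_abs]
    exact mul_le_of_le_one_left (norm_nonneg _) (Real.abs_sin_le_one t)

/-- `t ↦ L t` is continuous. [folklore] -/
theorem continuous_radialForm
    (hL : ∀ t, L t = Real.cos t • (EuclideanSpace.proj (𝕜 := ℝ) (0 : Fin 2) : EuclideanSpace ℝ (Fin 2) →L[ℝ] ℝ) +
      Real.sin t • (EuclideanSpace.proj (𝕜 := ℝ) (1 : Fin 2) : EuclideanSpace ℝ (Fin 2) →L[ℝ] ℝ)) :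
    Continuous L := by
  have hfun : L = fun t => Real.cos t • (EuclideanSpace.proj (𝕜 := ℝ) (0 : Fin 2) : EuclideanSpace ℝ (Fin 2) →L[ℝ] ℝ) +
      Real.sin t • (EuclideanSpace.proj (𝕜 := ℝ) (1 : Fin 2) : EuclideanSpace ℝ (Fin 2) →L[ℝ] ℝ) := funext hL
  rw [hfun]
  exact (Real.continuous_cos.smul continuous_const).add (Real.continuous_sin.smul continuous_const)

/-- The phase `y ↦ k(y₀ cos t + y₁ sin t) − t` has derivative `k·L t`. [folklore] -/
theorem hasFDerivAt_phase
    (hL : ∀ t, L t = Real.cos t • (EuclideanSpace.proj (𝕜 := ℝ) (0 : Fin 2) : EuclideanSpace ℝ (Fin 2) →L[ℝ] ℝ) +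
      Real.sin t • (EuclideanSpace.proj (𝕜 := ℝ) (1 : Fin 2) : EuclideanSpace ℝ (Fin 2) →L[ℝ] ℝ))
    (k t : ℝ) (y : EuclideanSpace ℝ (Fin 2)) :
    HasFDerivAt (fun y' : EuclideanSpace ℝ (Fin 2) => k * (y' 0 * Real.cos t + y' 1 * Real.sin t) - t) (k • L t) y := by
  rw [hL]
  exact ((((hasFDerivAt_coord_zero y).mul_const (Real.cos t)).add ((hasFDerivAt_coord_one y).mul_const (Real.sin t))).const_mul k).sub_const t

/-- **First derivative of the plane wave** `y ↦ cos(k(y₀ cos t + y₁ sin t) − t)`. [folklore] -/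
theorem hasFDerivAt_planeWave
    (hL : ∀ t, L t = Real.cos t • (EuclideanSpace.proj (𝕜 := ℝ) (0 : Fin 2) : EuclideanSpace ℝ (Fin 2) →L[ℝ] ℝ) +
      Real.sin t • (EuclideanSpace.proj (𝕜 := ℝ) (1 : Fin 2) : EuclideanSpace ℝ (Fin 2) →L[ℝ] ℝ))
    (k t : ℝ) (y : EuclideanSpace ℝ (Fin 2)) :
    HasFDerivAt (fun y' : EuclideanSpace ℝ (Fin 2) => Real.cos (k * (y' 0 * Real.cos t + y' 1 * Real.sin t) - t))
      ((-Real.sin (k * (y 0 * Real.cos t + y 1 * Real.sin t) - t)) • (k • L t)) y :=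
  (Real.hasDerivAt_cos _).comp_hasFDerivAt y (hasFDerivAt_phase hL k t y)

/-- **Second derivative of the plane wave**: the derivative of `y ↦ (−sin(phase))·(k L t)` is `h ↦ (−cos(phase)·k L t h)·(k L t)`. [folklore] -/
theorem hasFDerivAt_planeWave_deriv
    (hL : ∀ t, L t = Real.cos t • (EuclideanSpace.proj (𝕜 := ℝ) (0 : Fin 2) : EuclideanSpace ℝ (Fin 2) →L[ℝ] ℝ) +
      Real.sin t • (EuclideanSpace.proj (𝕜 := ℝ) (1 : Fin 2) : EuclideanSpace ℝ (Fin 2) →L[ℝ] ℝ))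
    (k t : ℝ) (y : EuclideanSpace ℝ (Fin 2)) :
    HasFDerivAt (fun y' : EuclideanSpace ℝ (Fin 2) => (-Real.sin (k * (y' 0 * Real.cos t + y' 1 * Real.sin t) - t)) • (k • L t))
      ((-(Real.cos (k * (y 0 * Real.cos t + y 1 * Real.sin t) - t) • (k • L t))).smulRight (k • L t)) y :=
  ((Real.hasDerivAt_sin _).comp_hasFDerivAt y (hasFDerivAt_phase hL k t y)).neg.smul_const (k • L t)

/-- The rotated phase: `(R_s y)₀ cos t + (R_s y)₁ sin t = y₀ cos(t − s) + y₁ sin(t − s)`. [folklore] -/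
theorem rotated_phase (y : EuclideanSpace ℝ (Fin 2)) (s t : ℝ) :
    (Real.cos s * y 0 - Real.sin s * y 1) * Real.cos t + (Real.sin s * y 0 + Real.cos s * y 1) * Real.sin t =
      y 0 * Real.cos (t - s) + y 1 * Real.sin (t - s) := by
  rw [Real.cos_sub, Real.sin_sub]
  ring

/-! ### Continuity and bounds of the integrands -/

/-- The phase is jointly continuous. [folklore] -/
theorem continuous_phase (k : ℝ) :
    Continuous fun p : EuclideanSpace ℝ (Fin 2) × ℝ => k * (p.1 0 * Real.cos p.2 + p.1 1 * Real.sin p.2) - p.2 := by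
  have hc0 : Continuous fun y : EuclideanSpace ℝ (Fin 2) => (y 0 : ℝ) := by
    simpa using (EuclideanSpace.proj (𝕜 := ℝ) (0 : Fin 2)).continuous
  have hc1 : Continuous fun y : EuclideanSpace ℝ (Fin 2) => (y 1 : ℝ) := by
    simpa using (EuclideanSpace.proj (𝕜 := ℝ) (1 : Fin 2)).continuous
  exact ((continuous_const.mul (((hc0.comp continuous_fst).mul (Real.continuous_cos.comp continuous_snd)).add
    ((hc1.comp continuous_fst).mul (Real.continuous_sin.comp continuous_snd)))).sub continuous_snd)

/-- The plane wave is jointly continuous. [folklore] -/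
theorem continuous_planeWave (k : ℝ) :
    Continuous fun p : EuclideanSpace ℝ (Fin 2) × ℝ => Real.cos (k * (p.1 0 * Real.cos p.2 + p.1 1 * Real.sin p.2) - p.2) :=
  Real.continuous_cos.comp (continuous_phase k)

/-- The first-derivative integrand is jointly continuous. [folklore] -/
theorem continuous_planeWave_deriv (hL : ∀ t, L t = Real.cos t • (EuclideanSpace.proj (𝕜 := ℝ) (0 : Fin 2) : EuclideanSpace ℝ (Fin 2) →L[ℝ] ℝ) +
      Real.sin t • (EuclideanSpace.proj (𝕜 := ℝ) (1 : Fin 2) : EuclideanSpace ℝ (Fin 2) →L[ℝ] ℝ)) (k : ℝ) :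
    Continuous fun p : EuclideanSpace ℝ (Fin 2) × ℝ =>
      (-Real.sin (k * (p.1 0 * Real.cos p.2 + p.1 1 * Real.sin p.2) - p.2)) • (k • L p.2) := by
  have hkL : Continuous fun p : EuclideanSpace ℝ (Fin 2) × ℝ => k • L p.2 :=
    ((continuous_radialForm hL).comp continuous_snd).const_smul k
  exact ((Real.continuous_sin.comp (continuous_phase k)).neg).smul hkL

/-- The second-derivative integrand is jointly continuous. [folklore] -/
theorem continuous_planeWave_deriv2 (hL : ∀ t, L t = Real.cos t • (EuclideanSpace.proj (𝕜 := ℝ) (0 : Fin 2) : EuclideanSpace ℝ (Fin 2) →L[ℝ] ℝ) +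
      Real.sin t • (EuclideanSpace.proj (𝕜 := ℝ) (1 : Fin 2) : EuclideanSpace ℝ (Fin 2) →L[ℝ] ℝ)) (k : ℝ) :
    Continuous fun p : EuclideanSpace ℝ (Fin 2) × ℝ =>
      (-(Real.cos (k * (p.1 0 * Real.cos p.2 + p.1 1 * Real.sin p.2) - p.2) • (k • L p.2))).smulRight (k • L p.2) := by
  have hkL : Continuous fun p : EuclideanSpace ℝ (Fin 2) × ℝ => k • L p.2 :=
    ((continuous_radialForm hL).comp continuous_snd).const_smul k
  have h1 : Continuous fun p : EuclideanSpace ℝ (Fin 2) × ℝ =>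
      -(Real.cos (k * (p.1 0 * Real.cos p.2 + p.1 1 * Real.sin p.2) - p.2) • (k • L p.2)) :=
    ((continuous_planeWave k).smul hkL).neg
  exact isBoundedBilinearMap_smulRight.continuous.comp (h1.prodMk hkL)

/-- The phase at a fixed point is continuous in the angle. [folklore] -/
theorem continuous_phase_at (k : ℝ) (y : EuclideanSpace ℝ (Fin 2)) :
    Continuous fun t : ℝ => k * (y 0 * Real.cos t + y 1 * Real.sin t) - t :=
  (continuous_const.mul ((continuous_const.mul Real.continuous_cos).add
    (continuous_const.mul Real.continuous_sin))).sub continuous_id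

/-- The plane wave at a fixed point is continuous in the angle. [folklore] -/
theorem continuous_planeWave_at (k : ℝ) (y : EuclideanSpace ℝ (Fin 2)) :
    Continuous fun t : ℝ => Real.cos (k * (y 0 * Real.cos t + y 1 * Real.sin t) - t) :=
  Real.continuous_cos.comp' (continuous_phase_at k y)

/-- The sine companion at a fixed point is continuous in the angle. [folklore] -/
theorem continuous_planeWaveSin_at (k : ℝ) (y : EuclideanSpace ℝ (Fin 2)) :
    Continuous fun t : ℝ => Real.sin (k * (y 0 * Real.cos t + y 1 * Real.sin t) - t) :=
  Real.continuous_sin.comp' (continuous_phase_at k y)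

/-- The first-derivative integrand at a fixed point is continuous in the angle. [folklore] -/
theorem continuous_planeWave_deriv_at (hL : ∀ t, L t = Real.cos t • (EuclideanSpace.proj (𝕜 := ℝ) (0 : Fin 2) : EuclideanSpace ℝ (Fin 2) →L[ℝ] ℝ) +
      Real.sin t • (EuclideanSpace.proj (𝕜 := ℝ) (1 : Fin 2) : EuclideanSpace ℝ (Fin 2) →L[ℝ] ℝ)) (k : ℝ) (y : EuclideanSpace ℝ (Fin 2)) :
    Continuous fun t : ℝ => (-Real.sin (k * (y 0 * Real.cos t + y 1 * Real.sin t) - t)) • (k • L t) :=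
  (continuous_planeWaveSin_at k y).neg.smul ((continuous_radialForm hL).const_smul k)

/-- The second-derivative integrand at a fixed point is continuous in the angle. [folklore] -/
theorem continuous_planeWave_deriv2_at (hL : ∀ t, L t = Real.cos t • (EuclideanSpace.proj (𝕜 := ℝ) (0 : Fin 2) : EuclideanSpace ℝ (Fin 2) →L[ℝ] ℝ) +
      Real.sin t • (EuclideanSpace.proj (𝕜 := ℝ) (1 : Fin 2) : EuclideanSpace ℝ (Fin 2) →L[ℝ] ℝ)) (k : ℝ) (y : EuclideanSpace ℝ (Fin 2)) :
    Continuous fun t : ℝ =>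
      (-(Real.cos (k * (y 0 * Real.cos t + y 1 * Real.sin t) - t) • (k • L t))).smulRight (k • L t) := by
  have hkL : Continuous fun t : ℝ => k • L t := (continuous_radialForm hL).const_smul k
  have h1 : Continuous fun t : ℝ => -(Real.cos (k * (y 0 * Real.cos t + y 1 * Real.sin t) - t) • (k • L t)) :=
    ((continuous_planeWave_at k y).smul hkL).neg
  exact isBoundedBilinearMap_smulRight.continuous.comp' (h1.prodMk hkL)

/-- Norm bound of the first-derivative integrand. [folklore] -/
theorem norm_planeWave_deriv_le (hL : ∀ t, L t = Real.cos t • (EuclideanSpace.proj (𝕜 := ℝ) (0 : Fin 2) : EuclideanSpace ℝ (Fin 2) →L[ℝ] ℝ) +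
      Real.sin t • (EuclideanSpace.proj (𝕜 := ℝ) (1 : Fin 2) : EuclideanSpace ℝ (Fin 2) →L[ℝ] ℝ)) (k t : ℝ) (y : EuclideanSpace ℝ (Fin 2)) :
    ‖(-Real.sin (k * (y 0 * Real.cos t + y 1 * Real.sin t) - t)) • (k • L t)‖ ≤ |k| * (‖(EuclideanSpace.proj (𝕜 := ℝ) (0 : Fin 2) : EuclideanSpace ℝ (Fin 2) →L[ℝ] ℝ)‖ + ‖(EuclideanSpace.proj (𝕜 := ℝ) (1 : Fin 2) : EuclideanSpace ℝ (Fin 2) →L[ℝ] ℝ)‖) := by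
  rw [norm_smul, norm_smul, Real.norm_eq_abs, Real.norm_eq_abs, abs_neg]
  calc |Real.sin _| * (|k| * ‖L t‖) ≤ 1 * (|k| * (‖(EuclideanSpace.proj (𝕜 := ℝ) (0 : Fin 2) : EuclideanSpace ℝ (Fin 2) →L[ℝ] ℝ)‖ + ‖(EuclideanSpace.proj (𝕜 := ℝ) (1 : Fin 2) : EuclideanSpace ℝ (Fin 2) →L[ℝ] ℝ)‖)) :=
        mul_le_mul (Real.abs_sin_le_one _) (mul_le_mul_of_nonneg_left (norm_radialForm_le hL t) (abs_nonneg k))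
          (by positivity) zero_le_one
    _ = _ := one_mul _

/-- Norm bound of the second-derivative integrand. [folklore] -/
theorem norm_planeWave_deriv2_le (hL : ∀ t, L t = Real.cos t • (EuclideanSpace.proj (𝕜 := ℝ) (0 : Fin 2) : EuclideanSpace ℝ (Fin 2) →L[ℝ] ℝ) +
      Real.sin t • (EuclideanSpace.proj (𝕜 := ℝ) (1 : Fin 2) : EuclideanSpace ℝ (Fin 2) →L[ℝ] ℝ)) (k t : ℝ) (y : EuclideanSpace ℝ (Fin 2)) :
    ‖(-(Real.cos (k * (y 0 * Real.cos t + y 1 * Real.sin t) - t) • (k • L t))).smulRight (k • L t)‖ ≤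
      |k| * (‖(EuclideanSpace.proj (𝕜 := ℝ) (0 : Fin 2) : EuclideanSpace ℝ (Fin 2) →L[ℝ] ℝ)‖ + ‖(EuclideanSpace.proj (𝕜 := ℝ) (1 : Fin 2) : EuclideanSpace ℝ (Fin 2) →L[ℝ] ℝ)‖) * (|k| * (‖(EuclideanSpace.proj (𝕜 := ℝ) (0 : Fin 2) : EuclideanSpace ℝ (Fin 2) →L[ℝ] ℝ)‖ + ‖(EuclideanSpace.proj (𝕜 := ℝ) (1 : Fin 2) : EuclideanSpace ℝ (Fin 2) →L[ℝ] ℝ)‖)) := by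
  rw [ContinuousLinearMap.norm_smulRight_apply, norm_neg, norm_smul, norm_smul, Real.norm_eq_abs, Real.norm_eq_abs]
  have hΛ := norm_radialForm_le hL t
  have h1 : |Real.cos (k * (y 0 * Real.cos t + y 1 * Real.sin t) - t)| * (|k| * ‖L t‖) ≤ |k| * (‖(EuclideanSpace.proj (𝕜 := ℝ) (0 : Fin 2) : EuclideanSpace ℝ (Fin 2) →L[ℝ] ℝ)‖ + ‖(EuclideanSpace.proj (𝕜 := ℝ) (1 : Fin 2) : EuclideanSpace ℝ (Fin 2) →L[ℝ] ℝ)‖) :=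
    (mul_le_mul (Real.abs_cos_le_one _) (mul_le_mul_of_nonneg_left hΛ (abs_nonneg k)) (by positivity) zero_le_one).trans
      (one_mul _).le
  have h2 : |k| * ‖L t‖ ≤ |k| * (‖(EuclideanSpace.proj (𝕜 := ℝ) (0 : Fin 2) : EuclideanSpace ℝ (Fin 2) →L[ℝ] ℝ)‖ + ‖(EuclideanSpace.proj (𝕜 := ℝ) (1 : Fin 2) : EuclideanSpace ℝ (Fin 2) →L[ℝ] ℝ)‖) := mul_le_mul_of_nonneg_left hΛ (abs_nonneg k)
  exact mul_le_mul h1 h2 (by positivity) (by positivity)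

/-! ### The witness `Ψ(y) = ∫₀^{2π} cos(k(y₀ cos t + y₁ sin t) − t) dt` and its derivatives -/

/-- **`DΨ = Ψ'`** (differentiation under the integral sign). [folklore] -/
theorem witness_hasFDerivAt {Ψ : EuclideanSpace ℝ (Fin 2) → ℝ} {Ψ' : EuclideanSpace ℝ (Fin 2) → EuclideanSpace ℝ (Fin 2) →L[ℝ] ℝ}
    (hL : ∀ t, L t = Real.cos t • (EuclideanSpace.proj (𝕜 := ℝ) (0 : Fin 2) : EuclideanSpace ℝ (Fin 2) →L[ℝ] ℝ) +
      Real.sin t • (EuclideanSpace.proj (𝕜 := ℝ) (1 : Fin 2) : EuclideanSpace ℝ (Fin 2) →L[ℝ] ℝ))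
    (hΨ : ∀ y, Ψ y = ∫ t in (0 : ℝ)..2 * Real.pi, Real.cos (k * (y 0 * Real.cos t + y 1 * Real.sin t) - t))
    (hΨ' : ∀ y, Ψ' y = ∫ t in (0 : ℝ)..2 * Real.pi, (-Real.sin (k * (y 0 * Real.cos t + y 1 * Real.sin t) - t)) • (k • L t))
    (y : EuclideanSpace ℝ (Fin 2)) : HasFDerivAt Ψ (Ψ' y) y := by
  have hΨf : Ψ = fun y => ∫ t in (0 : ℝ)..2 * Real.pi, Real.cos (k * (y 0 * Real.cos t + y 1 * Real.sin t) - t) := funext hΨ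
  rw [hΨf, hΨ']
  -- all type and instance arguments are fixed FIRST (scalar-valued case: otherwise the unifier meets
  -- `NormedSpace.toModule ?inst =?= (Module ℝ ℝ)` with an unsynthesised instance and diverges)
  have key := @intervalIntegral.hasFDerivAt_integral_of_dominated_of_fderiv_le ℝ _ volume ℝ _ _ _
    (EuclideanSpace ℝ (Fin 2)) _ _ univ 0 (2 * Real.pi)
    (fun _ => |k| * (‖(EuclideanSpace.proj (𝕜 := ℝ) (0 : Fin 2) : EuclideanSpace ℝ (Fin 2) →L[ℝ] ℝ)‖ +
      ‖(EuclideanSpace.proj (𝕜 := ℝ) (1 : Fin 2) : EuclideanSpace ℝ (Fin 2) →L[ℝ] ℝ)‖))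
  refine @key (fun y t => Real.cos (k * (y 0 * Real.cos t + y 1 * Real.sin t) - t))
    (fun y t => (-Real.sin (k * (y 0 * Real.cos t + y 1 * Real.sin t) - t)) • (k • L t)) y univ_mem
    ?_ ?_ ?_ ?_ ?_ ?_
  · exact Eventually.of_forall fun y' => (continuous_planeWave_at k y').aestronglyMeasurable
  · exact (continuous_planeWave_at k y).intervalIntegrable _ _
  · exact (continuous_planeWave_deriv_at hL k y).aestronglyMeasurable
  · exact Eventually.of_forall fun t _ y' _ => norm_planeWave_deriv_le hL k t y'
  · exact intervalIntegrable_const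
  · exact Eventually.of_forall fun t _ y' _ => hasFDerivAt_planeWave hL k t y'

/-- **`DΨ' = Ψ''`** (differentiation under the integral sign, second time). [folklore] -/
theorem witness_deriv_hasFDerivAt {Ψ' : EuclideanSpace ℝ (Fin 2) → EuclideanSpace ℝ (Fin 2) →L[ℝ] ℝ}
    {Ψ'' : EuclideanSpace ℝ (Fin 2) → EuclideanSpace ℝ (Fin 2) →L[ℝ] (EuclideanSpace ℝ (Fin 2) →L[ℝ] ℝ)}
    (hL : ∀ t, L t = Real.cos t • (EuclideanSpace.proj (𝕜 := ℝ) (0 : Fin 2) : EuclideanSpace ℝ (Fin 2) →L[ℝ] ℝ) +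
      Real.sin t • (EuclideanSpace.proj (𝕜 := ℝ) (1 : Fin 2) : EuclideanSpace ℝ (Fin 2) →L[ℝ] ℝ))
    (hΨ' : ∀ y, Ψ' y = ∫ t in (0 : ℝ)..2 * Real.pi, (-Real.sin (k * (y 0 * Real.cos t + y 1 * Real.sin t) - t)) • (k • L t))
    (hΨ'' : ∀ y, Ψ'' y = ∫ t in (0 : ℝ)..2 * Real.pi,
      (-(Real.cos (k * (y 0 * Real.cos t + y 1 * Real.sin t) - t) • (k • L t))).smulRight (k • L t))
    (y : EuclideanSpace ℝ (Fin 2)) : HasFDerivAt Ψ' (Ψ'' y) y := by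
  have hΨf : Ψ' = fun y => ∫ t in (0 : ℝ)..2 * Real.pi, (-Real.sin (k * (y 0 * Real.cos t + y 1 * Real.sin t) - t)) • (k • L t) :=
    funext hΨ'
  rw [hΨf, hΨ'']
  refine intervalIntegral.hasFDerivAt_integral_of_dominated_of_fderiv_le (𝕜 := ℝ) (μ := volume) (a := 0) (b := 2 * Real.pi)
    (x₀ := y)
    (bound := fun _ => |k| * (‖(EuclideanSpace.proj (𝕜 := ℝ) (0 : Fin 2) : EuclideanSpace ℝ (Fin 2) →L[ℝ] ℝ)‖ +
      ‖(EuclideanSpace.proj (𝕜 := ℝ) (1 : Fin 2) : EuclideanSpace ℝ (Fin 2) →L[ℝ] ℝ)‖) *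
      (|k| * (‖(EuclideanSpace.proj (𝕜 := ℝ) (0 : Fin 2) : EuclideanSpace ℝ (Fin 2) →L[ℝ] ℝ)‖ +
      ‖(EuclideanSpace.proj (𝕜 := ℝ) (1 : Fin 2) : EuclideanSpace ℝ (Fin 2) →L[ℝ] ℝ)‖)))
    (F := fun y t => (-Real.sin (k * (y 0 * Real.cos t + y 1 * Real.sin t) - t)) • (k • L t))
    (F' := fun y t => (-(Real.cos (k * (y 0 * Real.cos t + y 1 * Real.sin t) - t) • (k • L t))).smulRight (k • L t)) univ_mem
    ?_ ?_ ?_ ?_ ?_ ?_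
  · exact Eventually.of_forall fun y' => (continuous_planeWave_deriv_at hL k y').aestronglyMeasurable
  · exact (continuous_planeWave_deriv_at hL k y).intervalIntegrable _ _
  · exact (continuous_planeWave_deriv2_at hL k y).aestronglyMeasurable
  · exact Eventually.of_forall fun t _ y' _ => norm_planeWave_deriv2_le hL k t y'
  · exact intervalIntegrable_const
  · exact Eventually.of_forall fun t _ y' _ => hasFDerivAt_planeWave_deriv hL k t y'

/-- **`Ψ ∈ C²`**. [folklore] -/
theorem witness_contDiff {Ψ : EuclideanSpace ℝ (Fin 2) → ℝ} {Ψ' : EuclideanSpace ℝ (Fin 2) → EuclideanSpace ℝ (Fin 2) →L[ℝ] ℝ}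
    {Ψ'' : EuclideanSpace ℝ (Fin 2) → EuclideanSpace ℝ (Fin 2) →L[ℝ] (EuclideanSpace ℝ (Fin 2) →L[ℝ] ℝ)}
    (hL : ∀ t, L t = Real.cos t • (EuclideanSpace.proj (𝕜 := ℝ) (0 : Fin 2) : EuclideanSpace ℝ (Fin 2) →L[ℝ] ℝ) +
      Real.sin t • (EuclideanSpace.proj (𝕜 := ℝ) (1 : Fin 2) : EuclideanSpace ℝ (Fin 2) →L[ℝ] ℝ))
    (hΨ : ∀ y, Ψ y = ∫ t in (0 : ℝ)..2 * Real.pi, Real.cos (k * (y 0 * Real.cos t + y 1 * Real.sin t) - t))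
    (hΨ' : ∀ y, Ψ' y = ∫ t in (0 : ℝ)..2 * Real.pi, (-Real.sin (k * (y 0 * Real.cos t + y 1 * Real.sin t) - t)) • (k • L t))
    (hΨ'' : ∀ y, Ψ'' y = ∫ t in (0 : ℝ)..2 * Real.pi,
      (-(Real.cos (k * (y 0 * Real.cos t + y 1 * Real.sin t) - t) • (k • L t))).smulRight (k • L t)) :
    ContDiff ℝ 2 Ψ := by
  have hΨ''f : Ψ'' = fun y => ∫ t in (0 : ℝ)..2 * Real.pi,
      (-(Real.cos (k * (y 0 * Real.cos t + y 1 * Real.sin t) - t) • (k • L t))).smulRight (k • L t) := funext hΨ''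
  have hΨ''c : Continuous Ψ'' := by
    rw [hΨ''f]
    exact intervalIntegral.continuous_parametric_intervalIntegral_of_continuous' (continuous_planeWave_deriv2 hL k) _ _
  have hΨ'1 : ContDiff ℝ 1 Ψ' := contDiff_one_iff_hasFDerivAt.2 ⟨Ψ'', hΨ''c, witness_deriv_hasFDerivAt hL hΨ' hΨ''⟩
  have h := (contDiff_succ_iff_hasFDerivAt (𝕜 := ℝ) (f := Ψ) (n := 1)).2
    ⟨Ψ', by simpa using hΨ'1, witness_hasFDerivAt hL hΨ hΨ'⟩
  have h' : ContDiff ℝ 2 Ψ := by simpa [one_add_one_eq_two] using h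
  exact h'

/-- **`|Ψ| ≤ 2π`**. [folklore] -/
theorem witness_abs_le {Ψ : EuclideanSpace ℝ (Fin 2) → ℝ}
    (hΨ : ∀ y, Ψ y = ∫ t in (0 : ℝ)..2 * Real.pi, Real.cos (k * (y 0 * Real.cos t + y 1 * Real.sin t) - t)) (y : EuclideanSpace ℝ (Fin 2)) : |Ψ y| ≤ 2 * Real.pi := by
  have h := intervalIntegral.norm_integral_le_of_norm_le_const (a := (0 : ℝ)) (b := 2 * Real.pi) (C := 1)
    (f := fun t => Real.cos (k * (y 0 * Real.cos t + y 1 * Real.sin t) - t))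
    fun t _ => by rw [Real.norm_eq_abs]; exact Real.abs_cos_le_one _
  rw [Real.norm_eq_abs, sub_zero, abs_of_pos Real.two_pi_pos, one_mul, ← hΨ] at h
  exact h

end Summit.NavierStokesRegularity.NavierStokesRegularity.Theorems.PoloidalWindowDoorPoloidalWindowRigidityZShockRotatingProfileLinearWitnessCalculus
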